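import Literature.Combinatorics.SimpleGraph.GraphWeierstrassPoints
import Literature.Combinatorics.SimpleGraph.AbelJacobiBridgePaths
import Literature.Combinatorics.SimpleGraph.ChromaticPolynomialDeletionContraction
import HarnessLib

/-!
# Contracting a bridge preserves linear equivalence, the rank `r(D)`, hyperellipticity, the
# genus and Weierstrass points (Baker–Norine 2009, Lemma 46, Corollaries 49–50, Remark 64)

Source (held, read at the page; statements VERBATIM). M. Baker, S. Norine, *Harmonic morphisms
and hyperelliptic graphs*, Int. Math. Res. Not. IMRN 2009, no. 15, 2914–2955 [BakerNorine2009]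
(held text `paper:arxiv-0707.1309`, chunk p0017). **Lemma 46.** «Let `G` be a graph, let `Ḡ` be
the graph obtained by contracting every bridge of `G`, and let `ρ : G → Ḡ` be the natural
surjective morphism. Then for every divisor `D ∈ Div(G)`, we have `D ∼_G 0` if and only if
`ρ_*(D) ∼_{Ḡ} 0`, where `ρ_*(D)` is defined as in (2.4).» *Proof* (printed): «It suffices by
induction to prove the result with `Ḡ` replaced by the graph obtained by contracting a single
bridge `e`. […] Let `x₁, x₂` be the endpoints of `e` […] Let `G₁, G₂` be the connected components
of `G − e` containing `x₁` and `x₂`, respectively […]. Note that `(x₁) ∼ (x₂)` on `G`; this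
follows from the observation that `(x₁) − (x₂) = div(χ_{G₁})`. […]» **Remark 47.** «Note that
the morphism `ρ : G → Ḡ` is not necessarily harmonic.» **Corollary 49.** «[…] Then for every
divisor `D ∈ Div(G)`, we have `r_G(D) = r_{Ḡ}(ρ_*(D))`.» *Proof* (printed): «Suppose
`r(D) ≥ k`, and let `D̄ = ρ_*(D)`. Then for every effective divisor `E ∈ Div(G)` of degree `k`,
there exists an effective divisor `E′ ∈ Div(G)` such that `D − E ∼ E′`, and thus
`D̄ − ρ_*(E) ∼ ρ_*(E′)` by Lemma 46. Since `ρ_* : Div(G) → Div(Ḡ)` is surjective and preserves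
degrees and effectivity, it follows that `r(D̄) ≥ k`. Conversely, suppose `r(ρ_*(D)) ≥ k`. Then
for every effective divisor `E ∈ Div(G)` of degree `k`, there exists an effective divisor
`E′ ∈ Div(G)` such that `ρ_*(D) − ρ_*(E) ∼ ρ_*(E′)`. By Lemma 46, it follows that
`D − E ∼ E′`, and thus `r(D) ≥ k` as desired.» **Corollary 50.** «Let `G` be a graph, and let
`Ḡ` be the graph obtained by contracting every bridge of `G`. Then `G` is hyperelliptic if and
only if `Ḡ` is hyperelliptic.» (Proof: «This follows immediately from Corollary 49 and the
surjectivity of `ρ_* : Div(G) → Div(Ḡ)`.») **Remark 64** (§5.5, chunk p0021). «It follows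
from Corollary 49 that `x ∈ V(G)` is a Weierstrass point if and only if `ρ(x) ∈ V(Ḡ)` is a
Weierstrass point, where `Ḡ` is the 2-edge-connected graph obtained by contracting every bridge
of `G`. So without loss of generality, when studying Weierstrass points on graphs it suffices to
consider graphs which are 2-edge-connected.»

## What is formalised (simple graphs; ONE bridge at a time — the inductive step to which the
## printed proof reduces; `ρ_*` = `divPushforward ρ`, the contracted graph = `imageGraph ρ G`)

* `IsEdgeContraction x₁ x₂ ρ`: `ρ : V → W` is surjective with fibres `{x₁, x₂}` and singletons
  (the vertex map of `G → G/e`, `e = x₁x₂`); the model `contractMap` onto `{v // v ≠ x₂}`, whose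
  image graph is the tree's contraction `G.identify x₁ x₂` (`imageGraph_contractMap`);
* for a bridge `e = x₁x₂` (`G.Adj x₁ x₂`, Mathlib's `G.IsBridge s(x₁, x₂)`): the side `G₁` of
  `x₁` (`exists_bridge_side`); «`(x₁) − (x₂) = div(χ_{G₁})`» and «`(x₁) ∼ (x₂)`» are the
  lineage's `lapMatrix_mulVec_charFun_of_unique_edge` / `linEquiv_single_of_isBridge`
  (`AbelJacobiBridgePaths`, B–N 2007 Lemma 4.6), reused; `ρ_*(Δ_G(g ∘ ρ)) = Δ_{G/e}(g)`;
* **Lemma 46** `IsEdgeContraction.linEquiv_divPushforward_iff` (`ρ_* D ∼ ρ_* D′ ⟺ D ∼ D′`)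
  and `linEquiv_zero_iff_divPushforward` (as printed); **Corollary 49** `rank_divPushforward`
  (`r_{G/e}(ρ_* D) = r_G(D)`); **Corollary 50** `isHyperelliptic_imageGraph_iff`;
* `|V(G/e)| = |V(G)| − 1`, `|E(G/e)| = |E(G)| − 1`, so `g(G/e) = g(G)` (`genus_imageGraph`);
  **Remark 64** `isWeierstrassPoint_imageGraph_iff` (`ρ(x)` is a Weierstrass point of `G/e` iff
  `x` is one of `G`).
The statements about contracting every bridge at once follow by iterating (not typed here).

Definitions with bodies and theorems; no `sorry`; no named facts; no instances.
-/

open Finset SimpleGraph Matrix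
open Literature.Combinatorics.SimpleGraph.ChipFiring

namespace Literature.Combinatorics.SimpleGraph.BakerNorine

variable {V : Type*} [Fintype V] [DecidableEq V] (G : SimpleGraph V) [DecidableRel G.Adj]
variable {W : Type*} [Fintype W] [DecidableEq W]

/-! ### §1 Edge contraction maps -/

omit [Fintype V] [DecidableEq V] [Fintype W] [DecidableEq W] in
/-- The vertex map of the **contraction** `ρ : G → G/e` of the edge `e = x₁x₂`: surjective, it
identifies `x₁` with `x₂` and nothing else («let `ρ : G → Ḡ` be the natural surjective
morphism»). [cite: BakerNorine2009, Lemma 46] -/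
structure IsEdgeContraction (x₁ x₂ : V) (ρ : V → W) : Prop where
  surjective : Function.Surjective ρ
  apply_eq_iff : ∀ a b, ρ a = ρ b ↔ a = b ∨ (a = x₁ ∧ b = x₂) ∨ (a = x₂ ∧ b = x₁)

/-- The model contraction map onto `V ∖ {x₂}`: `x₂ ↦ x₁`, the identity elsewhere.
[cite: BakerNorine2009, Lemma 46 («the natural surjective morphism»)] -/
def contractMap {x₁ x₂ : V} (h : x₁ ≠ x₂) : V → {v : V // v ≠ x₂} :=
  fun v => if hv : v = x₂ then ⟨x₁, h⟩ else ⟨v, hv⟩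

omit [Fintype V] in
/-- `contractMap` off `x₂`. [cite: BakerNorine2009, Lemma 46] -/
theorem contractMap_apply_of_ne {x₁ x₂ : V} (h : x₁ ≠ x₂) {v : V} (hv : v ≠ x₂) :
    contractMap h v = ⟨v, hv⟩ :=
  dif_neg hv

omit [Fintype V] in
/-- `contractMap x₂ = x₁`. [cite: BakerNorine2009, Lemma 46] -/
theorem contractMap_apply_right {x₁ x₂ : V} (h : x₁ ≠ x₂) : contractMap h x₂ = ⟨x₁, h⟩ :=
  dif_pos rfl

omit [Fintype V] in
/-- `contractMap` is an edge contraction map. [cite: BakerNorine2009, Lemma 46] -/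
theorem isEdgeContraction_contractMap {x₁ x₂ : V} (h : x₁ ≠ x₂) :
    IsEdgeContraction x₁ x₂ (contractMap h) where
  surjective := fun ⟨v, hv⟩ => ⟨v, contractMap_apply_of_ne h hv⟩
  apply_eq_iff := fun a b => by
    by_cases ha : a = x₂ <;> by_cases hb : b = x₂
    · rw [ha, hb]
      simp
    · rw [ha, contractMap_apply_right, contractMap_apply_of_ne h hb, Subtype.mk.injEq]
      constructor
      · intro hab
        exact Or.inr (Or.inr ⟨rfl, hab.symm⟩)
      · rintro (hab | ⟨hab, -⟩ | ⟨-, hab⟩)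
        · exact absurd hab.symm hb
        · exact absurd hab.symm h
        · exact hab.symm
    · rw [hb, contractMap_apply_right, contractMap_apply_of_ne h ha, Subtype.mk.injEq]
      constructor
      · intro hab
        exact Or.inr (Or.inl ⟨hab, rfl⟩)
      · rintro (hab | ⟨hab, -⟩ | ⟨hab, -⟩)
        · exact absurd hab ha
        · exact hab
        · exact absurd hab ha
    · rw [contractMap_apply_of_ne h ha, contractMap_apply_of_ne h hb, Subtype.mk.injEq]
      constructor
      · intro hab
        exact Or.inl hab
      · rintro (hab | ⟨-, hab⟩ | ⟨hab, -⟩)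
        · exact hab
        · exact absurd hab hb
        · exact absurd hab ha

omit [Fintype V] [DecidableRel G.Adj] in
/-- The image graph of `G` under the model contraction map is the tree's contraction
`G.identify x₁ x₂` (`G · x₁x₂` of the chromatic-polynomial story).
[cite: BakerNorine2009, Lemma 46] -/
theorem imageGraph_contractMap {x₁ x₂ : V} (h : x₁ ≠ x₂) :
    imageGraph (contractMap h) G = G.identify x₁ x₂ := by
  ext u v
  rw [imageGraph_adj, SimpleGraph.identify_adj]
  refine and_congr_right fun huv => ⟨?_, ?_⟩
  · rintro ⟨a, b, ha, hb, hab⟩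
    by_cases ha2 : a = x₂
    · rw [ha2, contractMap_apply_right] at ha
      have hb2 : b ≠ x₂ := fun hb2 =>
        huv (by rw [← ha, ← hb, hb2, contractMap_apply_right])
      rw [contractMap_apply_of_ne h hb2] at hb
      rw [ha2] at hab
      refine Or.inr (Or.inl ⟨by rw [← ha], ?_⟩)
      rw [← hb]
      exact hab
    · rw [contractMap_apply_of_ne h ha2] at ha
      by_cases hb2 : b = x₂
      · rw [hb2, contractMap_apply_right] at hb
        rw [hb2] at hab
        refine Or.inr (Or.inr ⟨by rw [← hb], ?_⟩)
        rw [← ha]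
        exact hab.symm
      · rw [contractMap_apply_of_ne h hb2] at hb
        refine Or.inl ?_
        rw [← ha, ← hb]
        exact hab
  · rintro (hadj | ⟨hu, hadj⟩ | ⟨hv, hadj⟩)
    · exact ⟨u.1, v.1, by rw [contractMap_apply_of_ne h u.2], by rw [contractMap_apply_of_ne h v.2],
        hadj⟩
    · refine ⟨x₂, v.1, ?_, by rw [contractMap_apply_of_ne h v.2], hadj⟩
      rw [contractMap_apply_right]
      exact Subtype.ext hu.symm
    · refine ⟨u.1, x₂, by rw [contractMap_apply_of_ne h u.2], ?_, hadj.symm⟩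
      rw [contractMap_apply_right]
      exact Subtype.ext hv.symm

variable {G}

/-! ### §2 The side of a bridge -/

omit [DecidableEq V] [DecidableRel G.Adj] in
/-- The side `G₁ ∋ x₁` of a bridge `e = x₁x₂` («the connected component of `G − e` containing
`x₁`»): `x₂ ∉ G₁` and `e` is the only edge leaving `G₁`.
[cite: BakerNorine2009, Lemma 46 (proof)] -/
theorem exists_bridge_side {x₁ x₂ : V} (hb : G.IsBridge s(x₁, x₂)) :
    ∃ S : Finset V, x₁ ∈ S ∧ x₂ ∉ S ∧ ∀ u ∈ S, ∀ v ∉ S, G.Adj u v → u = x₁ ∧ v = x₂ := by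
  classical
  -- as in the lineage's `linEquiv_single_of_isBridge`: the vertices reachable from `x₁` in `G − e`
  have hmem : ∀ v, v ∈ univ.filter (fun v => (G.deleteEdges {s(x₁, x₂)}).Reachable x₁ v) ↔
      (G.deleteEdges {s(x₁, x₂)}).Reachable x₁ v := fun v => by
    rw [mem_filter]
    exact ⟨fun h => h.2, fun h => ⟨mem_univ _, h⟩⟩
  refine ⟨univ.filter fun v => (G.deleteEdges {s(x₁, x₂)}).Reachable x₁ v,
    (hmem _).2 (Reachable.refl _), fun h => isBridge_iff.1 hb ((hmem _).1 h),
    fun u hu v hv huv => ?_⟩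
  by_contra hne
  refine hv ((hmem _).2 (Reachable.trans ((hmem _).1 hu) (Adj.reachable ?_)))
  rw [deleteEdges_adj]
  refine ⟨huv, ?_⟩
  rw [Set.mem_singleton_iff, Sym2.eq_iff]
  rintro (⟨hu1, hv2⟩ | ⟨-, hv1⟩)
  · exact hne ⟨hu1, hv2⟩
  · rw [hv1] at hv
    exact hv ((hmem _).2 (Reachable.refl _))

section Side

variable {x₁ x₂ : V} {S : Finset V} (h₁ : x₁ ∈ S) (h₂ : x₂ ∉ S)
  (hS : ∀ u ∈ S, ∀ v ∉ S, G.Adj u v → u = x₁ ∧ v = x₂)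
include h₁ h₂ hS

omit [Fintype V] [DecidableEq V] [DecidableRel G.Adj] in
/-- The ends of a bridge have no common neighbour. [cite: BakerNorine2009, Lemma 46 (proof)] -/
theorem not_adj_of_bridge_side {u : V} (hu₁ : G.Adj x₁ u) (hu₂ : G.Adj x₂ u) : False := by
  by_cases hu : u ∈ S
  · have := (hS u hu x₂ h₂ hu₂.symm).1
    rw [this] at hu₁
    exact G.irrefl hu₁
  · have := (hS x₁ h₁ u hu hu₁).2
    rw [this] at hu₂
    exact G.irrefl hu₂

/-- `Δ(c χ_{G₁}) = c(x₁) − c(x₂)` («`(x₁) − (x₂) = div(χ_{G₁})`», the lineage's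
`lapMatrix_mulVec_charFun_of_unique_edge`). [cite: BakerNorine2009, Lemma 46 (proof)] -/
theorem lapMatrix_mulVec_smul_charFun_side (he : G.Adj x₁ x₂) (c : ℤ) :
    G.lapMatrix ℤ *ᵥ (c • charFun S) = Pi.single x₁ c - Pi.single x₂ c := by
  rw [Matrix.mulVec_smul, lapMatrix_mulVec_charFun_of_unique_edge h₁ h₂ he hS]
  funext v
  simp only [Pi.smul_apply, Pi.sub_apply, Pi.single_apply, smul_eq_mul]
  split_ifs <;> ring

end Side

/-! ### §3 Fibres of a contraction map and `ρ_*` -/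

namespace IsEdgeContraction

variable {x₁ x₂ : V} {ρ : V → W} (hρ : IsEdgeContraction x₁ x₂ ρ)
include hρ

omit [Fintype V] [DecidableEq V] [Fintype W] [DecidableEq W] in
/-- `ρ(x₂) = ρ(x₁)`. [cite: BakerNorine2009, Lemma 46] -/
theorem apply_eq : ρ x₂ = ρ x₁ := (hρ.apply_eq_iff x₂ x₁).2 (Or.inr (Or.inr ⟨rfl, rfl⟩))

omit [Fintype V] [DecidableEq V] [Fintype W] [DecidableEq W] in
/-- `ρ` is injective away from `{x₁, x₂}`. [cite: BakerNorine2009, Lemma 46 (proof: «`ρ⁻¹(z)`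
consists of a single element»)] -/
theorem eq_of_apply_eq {a b : V} (h : ρ a = ρ b) (ha₁ : a ≠ x₁) (ha₂ : a ≠ x₂) : a = b := by
  rcases (hρ.apply_eq_iff a b).1 h with h | ⟨h, -⟩ | ⟨h, -⟩
  · exact h
  · exact absurd h ha₁
  · exact absurd h ha₂

omit [DecidableEq V] [Fintype W] in
/-- The fibre of `ρ` over `ρ(v)`, `v ∉ {x₁, x₂}`, is `{v}`. [cite: BakerNorine2009, Lemma 46
(proof: «`ρ⁻¹(z)` consists of a single element»)] -/
theorem filter_eq_singleton {v : V} (hv₁ : v ≠ x₁) (hv₂ : v ≠ x₂) :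
    univ.filter (fun z => ρ z = ρ v) = {v} := by
  ext z
  rw [mem_filter, mem_singleton]
  constructor
  · rintro ⟨-, hz⟩
    exact (hρ.eq_of_apply_eq hz.symm hv₁ hv₂).symm
  · rintro rfl
    exact ⟨mem_univ _, rfl⟩

omit [Fintype W] in
/-- The fibre of `ρ` over `x̄ = ρ(x₁) = ρ(x₂)` is `{x₁, x₂}`. [cite: BakerNorine2009, Lemma 46
(proof: «`ρ⁻¹(z) = {x₁, x₂}`»)] -/
theorem filter_eq_pair : univ.filter (fun z => ρ z = ρ x₁) = {x₁, x₂} := by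
  ext z
  rw [mem_filter, mem_insert, mem_singleton]
  constructor
  · rintro ⟨-, hz⟩
    rcases (hρ.apply_eq_iff z x₁).1 hz with h | ⟨h, -⟩ | ⟨h, -⟩
    · exact Or.inl h
    · exact Or.inl h
    · exact Or.inr h
  · rintro (rfl | rfl)
    · exact ⟨mem_univ _, rfl⟩
    · exact ⟨mem_univ _, hρ.apply_eq⟩

omit [DecidableEq V] [Fintype W] in
/-- `ρ_*(D)(ρ v) = D(v)` off the contracted edge. [cite: BakerNorine2009, Lemma 46 (proof)] -/
theorem divPushforward_apply_of_ne (D : V → ℤ) {v : V} (hv₁ : v ≠ x₁) (hv₂ : v ≠ x₂) :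
    divPushforward ρ D (ρ v) = D v := by
  rw [divPushforward_apply, hρ.filter_eq_singleton hv₁ hv₂, sum_singleton]

omit [Fintype W] in
/-- `ρ_*(D)(x̄) = D(x₁) + D(x₂)`. [cite: BakerNorine2009, Lemma 46 (proof)] -/
theorem divPushforward_apply_left (hx : x₁ ≠ x₂) (D : V → ℤ) :
    divPushforward ρ D (ρ x₁) = D x₁ + D x₂ := by
  rw [divPushforward_apply, hρ.filter_eq_pair, sum_pair hx]

omit [Fintype W] in
/-- `ρ_*(c(x₁) − c(x₂)) = 0`. [cite: BakerNorine2009, Lemma 46 (proof)] -/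
theorem divPushforward_single_sub_single (c : ℤ) :
    divPushforward ρ (Pi.single x₁ c - Pi.single x₂ c) = 0 := by
  rw [divPushforward_sub, divPushforward_single, divPushforward_single, hρ.apply_eq, sub_self]

omit [Fintype W] in
/-- A divisor killed by `ρ_*` is a multiple of `(x₁) − (x₂)`. [cite: BakerNorine2009, Lemma 46
(proof: «using the fact that `(x₁) ∼ (x₂)` it is easy to see that `D ∼ div(χ_{{x₁,x₂}})`»)] -/
theorem eq_of_divPushforward_eq_zero (hx : x₁ ≠ x₂) {E : V → ℤ} (hE : divPushforward ρ E = 0) :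
    E = Pi.single x₁ (E x₁) - Pi.single x₂ (E x₁) := by
  have hsum : E x₁ + E x₂ = 0 := by
    rw [← hρ.divPushforward_apply_left hx, hE, Pi.zero_apply]
  funext v
  rw [Pi.sub_apply]
  by_cases hv₁ : v = x₁
  · rw [hv₁, Pi.single_eq_same, Pi.single_eq_of_ne hx, sub_zero]
  · by_cases hv₂ : v = x₂
    · rw [hv₂, Pi.single_eq_same, Pi.single_eq_of_ne (Ne.symm hx), zero_sub]
      omega
    · rw [Pi.single_eq_of_ne hv₁, Pi.single_eq_of_ne hv₂, sub_zero,
        ← hρ.divPushforward_apply_of_ne E hv₁ hv₂, hE, Pi.zero_apply]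

omit [Fintype V] [DecidableEq V] [Fintype W] [DecidableEq W] in
/-- A function constant on the contracted edge descends to `G/e`.
[cite: BakerNorine2009, Lemma 46 (proof)] -/
theorem exists_eq_comp {f : V → ℤ} (hf : f x₁ = f x₂) : ∃ g : W → ℤ, f = g ∘ ρ := by
  obtain ⟨σ, hσ⟩ := hρ.surjective.hasRightInverse
  refine ⟨f ∘ σ, funext fun v => ?_⟩
  simp only [Function.comp_apply]
  rcases (hρ.apply_eq_iff (σ (ρ v)) v).1 (hσ (ρ v)) with h | ⟨h1, h2⟩ | ⟨h1, h2⟩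
  · rw [h]
  · rw [h1, h2, hf]
  · rw [h1, h2, hf]

/-! ### §4 `ρ_*(Δ_G(g ∘ ρ)) = Δ_{G/e}(g)` for a bridge `e` -/

section Bridge

variable {S : Finset V} (h₁ : x₁ ∈ S) (h₂ : x₂ ∉ S)
  (hS : ∀ u ∈ S, ∀ v ∉ S, G.Adj u v → u = x₁ ∧ v = x₂)
include h₁ h₂ hS

omit [Fintype V] [DecidableEq V] [DecidableRel G.Adj] [Fintype W] [DecidableEq W] in
/-- One orientation of `eq_of_adj_of_apply_eq` below. [cite: BakerNorine2009, Lemma 46 (proof)] -/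
private theorem false_of_adj_aux {u u' z z' : V} (hzz : ρ z = ρ z') (hzu : G.Adj z u)
    (hzu' : G.Adj z' u') (huz : ρ u ≠ ρ z) (hu : u = x₁) (hu' : u' = x₂) : False := by
  rw [hu] at hzu huz
  rw [hu'] at hzu'
  rcases (hρ.apply_eq_iff z z').1 hzz with h | ⟨hz1, -⟩ | ⟨hz1, -⟩
  · rw [← h] at hzu'
    exact not_adj_of_bridge_side h₁ h₂ hS hzu.symm hzu'.symm
  · rw [hz1] at hzu
    exact G.irrefl hzu
  · rw [hz1] at huz
    exact huz hρ.apply_eq.symm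

omit [Fintype V] [DecidableEq V] [DecidableRel G.Adj] [Fintype W] [DecidableEq W] in
/-- Two vertices adjacent to one fibre of `ρ`, off that fibre's image, with the same image are
equal (the contraction of a bridge creates no parallel edges).
[cite: BakerNorine2009, Lemma 46 (proof)] -/
theorem eq_of_adj_of_apply_eq {u u' z z' : V} (hzz : ρ z = ρ z') (hzu : G.Adj z u)
    (hzu' : G.Adj z' u') (huz : ρ u ≠ ρ z) (huu : ρ u = ρ u') : u = u' := by
  rcases (hρ.apply_eq_iff u u').1 huu with h | ⟨hu, hu'⟩ | ⟨hu, hu'⟩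
  · exact h
  · exact (hρ.false_of_adj_aux h₁ h₂ hS hzz hzu hzu' huz hu hu').elim
  · have huz' : ρ u' ≠ ρ z' := by rwa [← huu, ← hzz]
    exact (hρ.false_of_adj_aux h₁ h₂ hS hzz.symm hzu' hzu huz' hu' hu).elim

/-- **`ρ_*(div(g ∘ ρ)) = div(g)`** on `G/e`: pushing forward the Laplacian of a function pulled
back from the contraction (the computation behind «`ρ_*(D)` is principal» / «`D` itself is
principal»). [cite: BakerNorine2009, Lemma 46 (proof)] -/
theorem divPushforward_lapMatrix_mulVec_comp [DecidableRel (imageGraph ρ G).Adj] (g : W → ℤ) :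
    divPushforward ρ (G.lapMatrix ℤ *ᵥ (g ∘ ρ)) = (imageGraph ρ G).lapMatrix ℤ *ᵥ g := by
  funext w
  rw [divPushforward_apply, lapMatrix_mulVec_apply_eq_sum_sub]
  set fib : Finset V := univ.filter (fun z => ρ z = w) with hfib
  have hmem : ∀ z, z ∈ fib ↔ ρ z = w := fun z => by rw [hfib, mem_filter]; simp
  have hdisj : (fib : Set V).PairwiseDisjoint (fun z => G.neighborFinset z) := by
    intro z hz z' hz' hne
    have hzz : ρ z = ρ z' := by rw [(hmem z).1 hz, (hmem z').1 hz']
    refine Finset.disjoint_left.2 fun u hu hu' => ?_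
    rw [mem_neighborFinset] at hu hu'
    rcases (hρ.apply_eq_iff z z').1 hzz with h | ⟨hz, hz'⟩ | ⟨hz, hz'⟩
    · exact hne h
    · rw [hz] at hu
      rw [hz'] at hu'
      exact not_adj_of_bridge_side h₁ h₂ hS hu hu'
    · rw [hz] at hu
      rw [hz'] at hu'
      exact not_adj_of_bridge_side h₁ h₂ hS hu' hu
  set B : Finset V := (fib.biUnion fun z => G.neighborFinset z).filter (fun u => ρ u ≠ w) with hB
  have hinj : Set.InjOn ρ (B : Set V) := by
    intro u hu u' hu' huu
    rw [Finset.mem_coe, hB, mem_filter, mem_biUnion] at hu hu'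
    obtain ⟨⟨z, hz, huz⟩, huw⟩ := hu
    obtain ⟨⟨z', hz', huz'⟩, -⟩ := hu'
    rw [mem_neighborFinset] at huz huz'
    rw [hmem] at hz hz'
    exact hρ.eq_of_adj_of_apply_eq h₁ h₂ hS (hz.trans hz'.symm) huz huz' (by rwa [hz]) huu
  have himage : B.image ρ = (imageGraph ρ G).neighborFinset w := by
    ext b
    rw [mem_image, mem_neighborFinset, imageGraph_adj]
    constructor
    · rintro ⟨u, hu, rfl⟩
      rw [hB, mem_filter, mem_biUnion] at hu
      obtain ⟨⟨z, hz, huz⟩, huw⟩ := hu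
      exact ⟨Ne.symm huw, z, u, (hmem z).1 hz, rfl, (mem_neighborFinset _ _ _).1 huz⟩
    · rintro ⟨hwb, z, u, hz, rfl, hzu⟩
      exact ⟨u, by
        rw [hB, mem_filter, mem_biUnion]
        exact ⟨⟨z, (hmem z).2 hz, (mem_neighborFinset _ _ _).2 hzu⟩, Ne.symm hwb⟩, rfl⟩
  calc ∑ z ∈ fib, (G.lapMatrix ℤ *ᵥ (g ∘ ρ)) z
      = ∑ z ∈ fib, ∑ u ∈ G.neighborFinset z, (g w - g (ρ u)) := by
        refine sum_congr rfl fun z hz => ?_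
        rw [lapMatrix_mulVec_apply_eq_sum_sub]
        simp only [Function.comp_apply, (hmem z).1 hz]
    _ = ∑ u ∈ fib.biUnion (fun z => G.neighborFinset z), (g w - g (ρ u)) :=
        (sum_biUnion hdisj).symm
    _ = ∑ u ∈ B, (g w - g (ρ u)) := by
        rw [hB, sum_filter]
        refine sum_congr rfl fun u _ => ?_
        by_cases h : ρ u = w
        · rw [if_neg (not_not.2 h), h, sub_self]
        · rw [if_pos h]
    _ = ∑ b ∈ B.image ρ, (g w - g b) := by rw [sum_image hinj]
    _ = ∑ b ∈ (imageGraph ρ G).neighborFinset w, (g w - g b) := by rw [himage]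

/-- **Lemma 46 (⇒)**: `ρ_*` maps principal divisors of `G` to principal divisors of `G/e` («we
want to show that `ρ_*(D)` is a principal divisor on `Ḡ`»). [cite: BakerNorine2009, Lemma 46] -/
theorem divPushforward_mem_laplacianLattice [DecidableRel (imageGraph ρ G).Adj]
    (he : G.Adj x₁ x₂) {D : V → ℤ} (hD : D ∈ laplacianLattice G) :
    divPushforward ρ D ∈ laplacianLattice (imageGraph ρ G) := by
  classical
  obtain ⟨f, rfl⟩ := (mem_laplacianLattice_iff G D).1 hD
  -- `f + c χ_{G₁}` is constant on `{x₁, x₂}` for `c = f(x₂) − f(x₁)`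
  set c : ℤ := f x₂ - f x₁ with hc
  have hf₁ : (f + c • charFun S) x₁ = (f + c • charFun S) x₂ := by
    simp only [Pi.add_apply, Pi.smul_apply, charFun_apply, h₁, h₂, if_true, if_false, smul_eq_mul,
      mul_one, mul_zero, add_zero, hc]
    ring
  obtain ⟨g, hg⟩ := hρ.exists_eq_comp hf₁
  have hsplit : G.lapMatrix ℤ *ᵥ f =
      G.lapMatrix ℤ *ᵥ (g ∘ ρ) - (Pi.single x₁ c - Pi.single x₂ c) := by
    rw [← hg, Matrix.mulVec_add, ← lapMatrix_mulVec_smul_charFun_side h₁ h₂ hS he c,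
      add_sub_cancel_right]
  rw [hsplit, divPushforward_sub, hρ.divPushforward_single_sub_single, sub_zero,
    hρ.divPushforward_lapMatrix_mulVec_comp h₁ h₂ hS g]
  exact (mem_laplacianLattice_iff _ _).2 ⟨g, rfl⟩

/-- **Lemma 46 (⇐)**: if `ρ_*(D)` is principal on `G/e` then `D` is principal on `G` («we want
to show that `D` itself is principal»). [cite: BakerNorine2009, Lemma 46] -/
theorem mem_laplacianLattice_of_divPushforward [DecidableRel (imageGraph ρ G).Adj]
    (he : G.Adj x₁ x₂) {D : V → ℤ}
    (hD : divPushforward ρ D ∈ laplacianLattice (imageGraph ρ G)) : D ∈ laplacianLattice G := by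
  classical
  have hx : x₁ ≠ x₂ := he.ne
  obtain ⟨g, hg⟩ := (mem_laplacianLattice_iff _ _).1 hD
  set E : V → ℤ := D - G.lapMatrix ℤ *ᵥ (g ∘ ρ) with hE
  have hE0 : divPushforward ρ E = 0 := by
    rw [hE, divPushforward_sub, hρ.divPushforward_lapMatrix_mulVec_comp h₁ h₂ hS g, hg, sub_self]
  have hEeq := hρ.eq_of_divPushforward_eq_zero hx hE0
  refine (mem_laplacianLattice_iff _ _).2 ⟨g ∘ ρ + E x₁ • charFun S, ?_⟩
  rw [Matrix.mulVec_add, lapMatrix_mulVec_smul_charFun_side h₁ h₂ hS he, ← hEeq, hE,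
    add_sub_cancel]

end Bridge

/-! ### §5 Lemma 46, Corollary 49, Corollary 50 -/

/-- **Lemma 46** (one bridge): `ρ_*(D) ∼ ρ_*(D′)` on `G/e` iff `D ∼ D′` on `G`.
[cite: BakerNorine2009, Lemma 46] -/
theorem linEquiv_divPushforward_iff [DecidableRel (imageGraph ρ G).Adj] (he : G.Adj x₁ x₂)
    (hb : G.IsBridge s(x₁, x₂)) (D D' : V → ℤ) :
    LinEquiv (imageGraph ρ G) (divPushforward ρ D) (divPushforward ρ D') ↔ LinEquiv G D D' := by
  obtain ⟨S, h₁, h₂, hS⟩ := exists_bridge_side hb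
  rw [BakerNorine.linEquiv_iff, BakerNorine.linEquiv_iff, ← divPushforward_sub]
  exact ⟨hρ.mem_laplacianLattice_of_divPushforward h₁ h₂ hS he,
    hρ.divPushforward_mem_laplacianLattice h₁ h₂ hS he⟩

/-- **Lemma 46** as printed: «for every divisor `D ∈ Div(G)`, we have `D ∼_G 0` if and only if
`ρ_*(D) ∼_{Ḡ} 0`» (one bridge). [cite: BakerNorine2009, Lemma 46] -/
theorem linEquiv_zero_iff_divPushforward [DecidableRel (imageGraph ρ G).Adj] (he : G.Adj x₁ x₂)
    (hb : G.IsBridge s(x₁, x₂)) (D : V → ℤ) :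
    LinEquiv G D 0 ↔ LinEquiv (imageGraph ρ G) (divPushforward ρ D) 0 := by
  rw [← divPushforward_zero ρ, hρ.linEquiv_divPushforward_iff he hb]

omit [Fintype V] [DecidableEq V] [DecidableRel G.Adj] [Fintype W] [DecidableEq W] hρ in
/-- Two integers `≥ −1` below which lie the same naturals are equal (used to compare ranks through
B–N's «`r(D) ≥ k` iff …»). [folklore] -/
private theorem int_eq_of_forall_nat_le_iff {a b : ℤ} (ha : -1 ≤ a) (hb : -1 ≤ b)
    (h : ∀ s : ℕ, (s : ℤ) ≤ a ↔ (s : ℤ) ≤ b) : a = b := by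
  rcases le_or_gt 0 a with ha0 | ha0
  · obtain ⟨n, rfl⟩ := Int.eq_ofNat_of_zero_le ha0
    have h1 := (h n).1 le_rfl
    rcases le_or_gt 0 b with hb0 | hb0
    · obtain ⟨m, rfl⟩ := Int.eq_ofNat_of_zero_le hb0
      have h2 := (h m).2 le_rfl
      omega
    · omega
  · rcases le_or_gt 0 b with hb0 | hb0
    · obtain ⟨m, rfl⟩ := Int.eq_ofNat_of_zero_le hb0
      have h2 := (h m).2 le_rfl
      omega
    · omega

/-- **Corollary 49** (one bridge): «`r_G(D) = r_{Ḡ}(ρ_*(D))`» — the printed proof, through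
B–N's definition of `r` and «`ρ_*` is surjective and preserves degrees and effectivity».
[cite: BakerNorine2009, Corollary 49] -/
theorem rank_divPushforward [DecidableRel (imageGraph ρ G).Adj] (he : G.Adj x₁ x₂)
    (hb : G.IsBridge s(x₁, x₂)) (D : V → ℤ) :
    rank (imageGraph ρ G) (divPushforward ρ D) = rank G D := by
  haveI : Nonempty V := ⟨x₁⟩
  haveI : Nonempty W := ⟨ρ x₁⟩
  refine (int_eq_of_forall_nat_le_iff (neg_one_le_rank _ _) (neg_one_le_rank _ _)
    fun s => ?_).symm
  rw [le_rank_iff, le_rank_iff]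
  constructor
  · -- «Suppose `r(D) ≥ k` […] it follows that `r(D̄) ≥ k`»
    intro h E' hE' hs'
    obtain ⟨E, hEE', hEs, hEnn⟩ := exists_divPushforward_eq hρ.surjective E'
    obtain ⟨F, hF, hDF⟩ := h E (hEnn hE') (by rw [hEs, hs'])
    refine ⟨divPushforward ρ F, divPushforward_nonneg ρ hF, ?_⟩
    rw [← hEE', ← divPushforward_sub]
    exact (hρ.linEquiv_divPushforward_iff he hb _ _).2 hDF
  · -- «Conversely, suppose `r(ρ_*(D)) ≥ k` […] thus `r(D) ≥ k` as desired»
    intro h E hE hs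
    obtain ⟨F', hF', hDF'⟩ :=
      h (divPushforward ρ E) (divPushforward_nonneg ρ hE) (by rw [sum_divPushforward, hs])
    obtain ⟨F, hFF', -, hFnn⟩ := exists_divPushforward_eq hρ.surjective F'
    refine ⟨F, hFnn hF', ?_⟩
    rw [← divPushforward_sub, ← hFF'] at hDF'
    exact (hρ.linEquiv_divPushforward_iff he hb _ _).1 hDF'

/-- **Corollary 50** (one bridge): `G/e` is hyperelliptic iff `G` is («This follows immediately
from Corollary 49 and the surjectivity of `ρ_*`»). [cite: BakerNorine2009, Corollary 50] -/
theorem isHyperelliptic_imageGraph_iff [DecidableRel (imageGraph ρ G).Adj] (he : G.Adj x₁ x₂)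
    (hb : G.IsBridge s(x₁, x₂)) : IsHyperelliptic (imageGraph ρ G) ↔ IsHyperelliptic G := by
  constructor
  · rintro ⟨D', hD'2, hr'⟩
    obtain ⟨D, hDD', hDs, -⟩ := exists_divPushforward_eq hρ.surjective D'
    refine ⟨D, by rw [hDs, hD'2], ?_⟩
    rw [← hρ.rank_divPushforward he hb D, hDD', hr']
  · rintro ⟨D, hD2, hr⟩
    exact ⟨divPushforward ρ D, by rw [sum_divPushforward, hD2],
      by rw [hρ.rank_divPushforward he hb, hr]⟩

/-! ### §6 The genus of `G/e` -/

omit [DecidableRel G.Adj] in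
/-- `|V(G/e)| = |V(G)| − 1`. [cite: BakerNorine2009, Lemma 46 (the contraction `Ḡ`)] -/
theorem card_verts_add_one (hx : x₁ ≠ x₂) : Fintype.card W + 1 = Fintype.card V := by
  have himage : (univ.erase x₂).image ρ = univ := by
    rw [eq_univ_iff_forall]
    intro w
    obtain ⟨v, rfl⟩ := hρ.surjective w
    by_cases hv : v = x₂
    · exact mem_image.2 ⟨x₁, mem_erase.2 ⟨hx, mem_univ _⟩, by rw [hv, hρ.apply_eq]⟩
    · exact mem_image.2 ⟨v, mem_erase.2 ⟨hv, mem_univ _⟩, rfl⟩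
  have hinj : Set.InjOn ρ ↑(univ.erase x₂) := by
    intro a ha b hb hab
    rw [Finset.mem_coe, mem_erase] at ha hb
    rcases (hρ.apply_eq_iff a b).1 hab with h | ⟨-, h⟩ | ⟨h, -⟩
    · exact h
    · exact absurd h hb.1
    · exact absurd h ha.1
  rw [← Finset.card_univ (α := W), ← himage, Finset.card_image_of_injOn hinj,
    Finset.card_erase_of_mem (mem_univ _), Finset.card_univ]
  exact Nat.sub_add_cancel (Fintype.card_pos_iff.2 ⟨x₁⟩)

/-- `|E(G/e)| = |E(G)| − 1` for a bridge `e` (no parallel edges are created: the ends of a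
bridge have no common neighbour). [cite: BakerNorine2009, Lemma 46 (the contraction `Ḡ`)] -/
theorem card_edgeFinset_add_one [DecidableRel (imageGraph ρ G).Adj] (he : G.Adj x₁ x₂)
    (hb : G.IsBridge s(x₁, x₂)) : #(imageGraph ρ G).edgeFinset + 1 = #G.edgeFinset := by
  obtain ⟨S, h₁, h₂, hS⟩ := exists_bridge_side hb
  -- two edges other than `e` with the same image coincide
  have hpair : ∀ {a b a' b' : V}, G.Adj a b → s(a, b) ≠ s(x₁, x₂) → ρ a = ρ a' → ρ b = ρ b' →
      G.Adj a' b' → a = a' ∧ b = b' := by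
    intro a b a' b' hab hne ha hb' ha'b'
    rcases (hρ.apply_eq_iff a a').1 ha with h | ⟨ha1, ha2⟩ | ⟨ha1, ha2⟩ <;>
      rcases (hρ.apply_eq_iff b b').1 hb' with h' | ⟨hb1, hb2⟩ | ⟨hb1, hb2⟩
    · exact ⟨h, h'⟩
    · rw [hb1] at hab
      rw [← h, hb2] at ha'b'
      exact (not_adj_of_bridge_side h₁ h₂ hS hab.symm ha'b'.symm).elim
    · rw [hb1] at hab
      rw [← h, hb2] at ha'b'
      exact (not_adj_of_bridge_side h₁ h₂ hS ha'b'.symm hab.symm).elim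
    · rw [ha1] at hab
      rw [ha2, ← h'] at ha'b'
      exact (not_adj_of_bridge_side h₁ h₂ hS hab ha'b').elim
    · rw [ha1, hb1] at hab
      exact (G.irrefl hab).elim
    · exact (hne (by rw [ha1, hb1])).elim
    · rw [ha1] at hab
      rw [ha2, ← h'] at ha'b'
      exact (not_adj_of_bridge_side h₁ h₂ hS ha'b' hab).elim
    · exact (hne (by rw [ha1, hb1, Sym2.eq_swap])).elim
    · rw [ha1, hb1] at hab
      exact (G.irrefl hab).elim
  have hset : (imageGraph ρ G).edgeFinset = (G.edgeFinset.erase s(x₁, x₂)).image (Sym2.map ρ) := by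
    ext e
    induction e using Sym2.ind
    rename_i a b
    rw [mem_edgeFinset, mem_edgeSet, imageGraph_adj, mem_image]
    constructor
    · rintro ⟨hab, x, y, rfl, rfl, hxy⟩
      refine ⟨s(x, y), mem_erase.2 ⟨fun h => hab ?_, mem_edgeFinset.2 hxy⟩, Sym2.map_mk ρ x y⟩
      rcases Sym2.eq_iff.1 h with ⟨hx, hy⟩ | ⟨hx, hy⟩
      · rw [hx, hy, hρ.apply_eq]
      · rw [hx, hy, hρ.apply_eq]
    · rintro ⟨e, he', hee⟩
      induction e using Sym2.ind
      rename_i x y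
      rw [mem_erase, mem_edgeFinset, mem_edgeSet] at he'
      rw [Sym2.map_mk, Sym2.eq_iff] at hee
      have hxy : ρ x ≠ ρ y := by
        intro h
        rcases (hρ.apply_eq_iff x y).1 h with h' | ⟨hx, hy⟩ | ⟨hx, hy⟩
        · rw [h'] at he'
          exact G.irrefl he'.2
        · exact he'.1 (by rw [hx, hy])
        · exact he'.1 (by rw [hx, hy, Sym2.eq_swap])
      rcases hee with ⟨rfl, rfl⟩ | ⟨rfl, rfl⟩
      · exact ⟨hxy, x, y, rfl, rfl, he'.2⟩
      · exact ⟨hxy.symm, y, x, rfl, rfl, he'.2.symm⟩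
  have hinj : Set.InjOn (Sym2.map ρ) ↑(G.edgeFinset.erase s(x₁, x₂)) := by
    intro e₁ he₁ e₂ he₂ h
    rw [Finset.mem_coe, mem_erase, mem_edgeFinset] at he₁ he₂
    induction e₁ using Sym2.ind
    rename_i a b
    induction e₂ using Sym2.ind
    rename_i a' b'
    rw [mem_edgeSet] at he₁ he₂
    rw [Sym2.map_mk, Sym2.map_mk, Sym2.eq_iff] at h
    rcases h with ⟨ha, hb'⟩ | ⟨ha, hb'⟩
    · obtain ⟨rfl, rfl⟩ := hpair he₁.2 he₁.1 ha hb' he₂.2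
      rfl
    · obtain ⟨rfl, rfl⟩ := hpair he₁.2 he₁.1 ha hb' he₂.2.symm
      exact Sym2.eq_swap
  have he' : s(x₁, x₂) ∈ G.edgeFinset := mem_edgeFinset.2 (G.mem_edgeSet.2 he)
  rw [hset, Finset.card_image_of_injOn hinj, Finset.card_erase_of_mem he']
  exact Nat.sub_add_cancel (Finset.card_pos.2 ⟨_, he'⟩)

/-- **`g(G/e) = g(G)`** for a bridge `e`. [cite: BakerNorine2009, Lemma 46 (the contraction
`Ḡ`), §1.3 («`g = |E(G)| − |V(G)| + 1` is the genus»)] -/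
theorem genus_imageGraph [DecidableRel (imageGraph ρ G).Adj] (he : G.Adj x₁ x₂)
    (hb : G.IsBridge s(x₁, x₂)) : genus (imageGraph ρ G) = genus G := by
  rw [genus_eq, genus_eq, ← hρ.card_verts_add_one he.ne, ← hρ.card_edgeFinset_add_one he hb]
  push_cast
  ring

/-! ### §7 Remark 64: Weierstrass points under bridge contraction -/

/-- **Remark 64** (one bridge): «`x ∈ V(G)` is a Weierstrass point if and only if `ρ(x) ∈ V(Ḡ)`
is a Weierstrass point» (Corollary 49 with `ρ_*(g(x)) = g(ρ(x))` and `g(G/e) = g(G)`).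
[cite: BakerNorine2009, Remark 64] -/
theorem isWeierstrassPoint_imageGraph_iff [DecidableRel (imageGraph ρ G).Adj] (he : G.Adj x₁ x₂)
    (hb : G.IsBridge s(x₁, x₂)) (x : V) :
    IsWeierstrassPoint (imageGraph ρ G) (ρ x) ↔ IsWeierstrassPoint G x := by
  rw [isWeierstrassPoint_iff, isWeierstrassPoint_iff, hρ.genus_imageGraph he hb,
    ← divPushforward_single ρ x, hρ.rank_divPushforward he hb]

end IsEdgeContraction

end Literature.Combinatorics.SimpleGraph.BakerNorine
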